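import Summits.ABC.IUTFork.Repair.CandJoshi22Tests
import Summits.ABC.IUTFork.Repair.CandJoshi21
import HarnessLib

/-!
# IUT REPAIR BRANCH (LADDER-ABC:A2.RP), class (iii) JOSHI, j2 — the scaling model's tests RESTATED in the H-vocabulary of `CandJoshi21`
# (row RP-J05: H_J21-2 `JoshiScalingIndeterminacy`, H_J21-5 `JoshiNonIsometricIndeterminacy`; definitional restatements, proof-only)

Record file of the abc-iut cell's IUT REPAIR BRANCH (seat abc-iut-rp-j2). `Repair/CandJoshi22Tests` (p432807) states H_J21-2 / H_J21-5 by
their defining formulas because `Repair.CandJoshi21`'s olean was not served at filing time; this file folds them back (each by `exact`, the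
statements being definitionally equal) so that the CANDIDATES.tsv cells of RP-J05 name abc-iut-rp-j2's candidate predicates literally.
TAKES NO SIDE on [IUTchIII] Cor. 3.12 or on any author; proof-only, 0 defs; typed ≠ proved ≠ endorsed. [claim: Joshi2023ATS2Local, status: disputed]
-/

noncomputable section

open Set

namespace Summit.ABC.IUTFork.Repair.CandJoshi22

open Thm311 Cor312 Cor312.Checks Cor312.IdentifiedNonVacuity Cor312Vol Cor312Vol.NaiveWitness Cor312Vol.PinnedWitness
  Literature.IUT.LogThetaLattice Summit.ABC.IUTFork.Repair

variable (p : ℕ) [hp : Fact p.Prime]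

/-- **H_J21-2 `JoshiScalingIndeterminacy` HOLDS in the scaling model** (folded form of `scale_H2`; witness `sFamDep (cQ p)`, not the
identity). [claim: Joshi2023ATS2Local, status: disputed] -/
theorem scale_joshiScalingIndeterminacy :
    JoshiScalingIndeterminacy (scaleFull p).toLatticeSituation (scaleSetting p) (qDatum p) :=
  scale_H2 p

/-- **H_J21-5 `JoshiNonIsometricIndeterminacy` HOLDS in the scaling model** (folded form of `scale_H5`). [claim: Joshi2021ATS1, status: disputed] -/
theorem scale_joshiNonIsometricIndeterminacy (n : ℤ) : JoshiNonIsometricIndeterminacy (scaleSituation p) n :=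
  scale_H5 p n

/-- **(T-c) of RP-J05 in the H-vocabulary**: ∃ (T, F, P, ρ, qK) with typed Thm. 3.11 ∧ AbsLogQPos ∧ PinnedRegions3 ∧ H_J21-2 ∧ H_J21-5 ∧ S
∧ ¬ThetaFinite ∧ ¬BridgeHyps — the scaling model at `p = 2` (grade SAT⊖(Step (x)); UNSAT with `BridgeHyps`: `ObstructionSS2`).
[claim: Joshi2023ATS2Local, status: disputed] -/
theorem joshi_doorA_satisfiable_without_finiteness :
    ∃ (T : ThetaIndex) (F : FullSituation T) (P : Setting F.toLatticeSituation.toSituation)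
      (ρ : (∀ v : T.V, v ∈ T.Vbad → Set (F.L.StarPacket v)) → ∀ (j : T.Label) (vQ : T.VQ), Set (F.L.Packet j vQ))
      (qK : ∀ v : T.V, v ∈ T.Vbad → Set (F.L.StarPacket v)),
      F.Statement ∧ P.AbsLogQPos ∧ PinnedRegions3 F.toLatticeSituation P ρ qK ∧
        JoshiScalingIndeterminacy F.toLatticeSituation P qK ∧ JoshiNonIsometricIndeterminacy F.toSituation P.n ∧
        PilotKummerIndRelated F.toLatticeSituation P ρ qK ∧ ¬ P.ThetaFinite ∧ ¬ BridgeHyps P := by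
  haveI : Fact (Nat.Prime 2) := ⟨Nat.prime_two⟩
  exact ⟨toyIndex, scaleFull 2, scaleSetting 2, scaleRho 2, qDatum 2, scaleFull_statement 2, scale_absLogQPos 2,
    scale_pinnedRegions3 2, scale_joshiScalingIndeterminacy 2, scale_joshiNonIsometricIndeterminacy 2 _, scale_residual 2,
    scale_not_thetaFinite 2, scale_not_bridgeHyps 2⟩

end Summit.ABC.IUTFork.Repair.CandJoshi22

end
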